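import Summits.BirchSwinnertonDyer.BirchSwinnertonDyer.Theorems.ByReductionTypeAtTwoMultTransportTwistedDescentTateLine
import Literature.NumberTheory.EllipticCurves.ZpExtensionGaloisTwistWeilDual
import Literature.NumberTheory.GaloisRepresentations.ContinuousRepHomDual
import Literature.NumberTheory.GaloisRepresentations.ContinuousCohomologyConnecting
import Literature.NumberTheory.GaloisRepresentations.CorNaturality
import Literature.NumberTheory.GaloisRepresentations.FiniteCoefficients
import HarnessLib

/-!
# T-42-mult in the kernel, XXIX: the dual Kummer condition at the prime `2` (`δ2` of file XXIV′/XXVI) — PROVED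

Cell `bsd-2adic` (run/shared/lean/pub/bsd-2adic/), seat `bsd-2adic-t42` (BRIEF-T42), GEN 17. HONEST FRAMING:
research route; THEOREMS ONLY (no `def`, no named fact, no instance); nothing booked; nothing re-keyed
(RC-169); BSD is not proved by any of this. PARTITION: X5@2 multiplicative GV-transport rows (K4ᵐ B1·O1; the
LOCAL statement `δ2` at the prime `2` left of `hF3b` by XXVI `…TwistedDescentLocalTwo.lean`) × p = 2 —
types-the-object-of; bears_on K4 items 19922 / 19923 (`--supports stmt-BirchSwinnertonDyer-19923`).

## What (HOME/t42/DESIGN-T42-ADDENDUM-17.md §A17.3, brick (δ2))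

At a place `v ∣ p` of MULTIPLICATIVE reduction of `E/K` (`K` a number field, `κ` the cyclotomic `ℤ_p`-extension,
`G_K = (ker κ)_v`), for the twisted modules `M_u = E[p^J](χ_u)`, `M_{u'} = E[p^J](χ_{u'})` (`u u' ≡ 1 mod p^J`)
and the twisted Weil duality `w : M_{u'} ⥲ M_u^D` of an alternating non-degenerate equivariant `e`:
**if `y' ∈ H¹(K_v, M_{u'})` pairs to zero, under `ι_v ∘ (local Tate pairing) ∘ H¹(w)`, with every class of
`H¹(K_v, M_u)` killed by `twistedTorsionToLocalH1^{(u)}`, then `twistedTorsionToLocalH1^{(u')} y' = 0`**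
(`twistedTorsionToLocalH1_eq_zero_of_dual_finitePlace`; `δ2` of XXIV′ verbatim: `dualKummerAtTwo`).

Proof (Greenberg p. 123, «`L_v^*` … defined just as `L_v`», at finite level). Let `C = C_J ⊆ E[p^J]` be the
Tate line (XXVII/XXVIII: cyclic of order `p^J`, maximal isotropic, `Γ_{K_v}`-stable in both twists, and
`H¹(K_v, C(χ)) → H¹(K_v, M) → H¹(G_K, E)` is ZERO — the local form of Prop. 2.4-multiplicative).
(1) The hypothesis applied to the classes from `H¹(K_v, C(χ_u))` says that `H¹(e_D ∘ w) y'` is orthogonal to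
`Im H¹(i)` under the duality pairing of `M_u|_{K_v}` over the local field `K_v` (transport
`iota_cupProduct_localPairingF`, `ι_v` injective). (2) Adjunction (`cupProduct_adjoint` for `i : C ↪ M_u`,
`i^D : M_u^D → C^D`) and local Tate duality for the LOCAL module `C(χ_u)` over `K_v` (`localDuality_bijective`)
give `H¹(i^D ∘ e_D ∘ w) y' = 0`. (3) The composite `θ = i^D ∘ e_D ∘ w : M_{u'} → Hom(C, μ)`,
`m' ↦ e(·, m')|_C`, is SURJECTIVE (restriction of characters, `isSES_homRepMap_mkQ_subtype`; `w`, `e_D`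
bijective) with kernel `C^⊥ = C` (maximal isotropy): `0 → C(χ_{u'}) → M_{u'} → Hom(C(χ_u), μ) → 0` is short
exact, so by the long exact sequence (`IsSES.exists_map_one_eq_of_map_one_eq_zero`) `y'` comes from
`H¹(K_v, C(χ_{u'}))`, (4) whose classes die under `twistedTorsionToLocalH1^{(u')}` (XXVIII).

References: [GreenbergLNM1716] §2 pp. 74–76, §4 pp. 123–124; [MilneADT2006] I Cor. 2.3, I §6;
[SerreGaloisCohomology1997] II §5.2; [SilvermanAEC2009] III.8.1.
-/

set_option autoImplicit false
set_option linter.dupNamespace false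

noncomputable section

open scoped Classical AddSubgroup ContRepresentation

namespace Summit.BirchSwinnertonDyer.BirchSwinnertonDyer.Theorems.MultTransportTwistedDescent

open NumberField IsDedekindDomain Field WeierstrassCurve CategoryTheory Function
  Literature.NumberTheory.GaloisRepresentations Literature.NumberTheory.EllipticCurves
  Literature.NumberTheory.EllipticCurves.GreenbergSelmer IsDedekindDomain.HeightOneSpectrum
  Summit.BirchSwinnertonDyer.Rank1Residual.X2
open Literature.NumberTheory.GaloisRepresentations.DiscreteGaloisModule (localTatePairingZMod localTatePairing
  TateDual tateDual mu MuCarrier)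

/-! ## The dual Kummer condition at a multiplicative `v ∣ p`, any number field -/

section NumberField

variable {K : Type} [Field K] [NumberField K] (W : WeierstrassCurve K) [W.IsElliptic] (p : ℕ)
  [hp : Fact p.Prime] (κ : ZpExtension K p) (J : ℕ) {u u' : ℤ} (hu : (p : ℤ) ∣ u - 1) (hu' : (p : ℤ) ∣ u' - 1)
  (huu' : ((p : ℤ) ^ J) ∣ u * u' - 1)
  (e : W.geomTorsion ((p ^ J : ℕ) : ℤ) → W.geomTorsion ((p ^ J : ℕ) : ℤ) → AlgebraicClosure K)
  (hμ : ∀ S T, e S T ^ (p ^ J) = 1)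
  (hadd₁ : ∀ S₁ S₂ T, e (S₁ + S₂) T = e S₁ T * e S₂ T)
  (hadd₂ : ∀ S T₁ T₂, e S (T₁ + T₂) = e S T₁ * e S T₂)
  (hgal : ∀ (σ : absoluteGaloisGroup K) (S T : W.geomTorsion ((p ^ J : ℕ) : ℤ)),
    σ • e S T = e (σ • S) (σ • T))
  (halt : ∀ T, e T T = 1) (hnondeg : ∀ T, (∀ S, e S T = 1) → T = 0)
  [Finite (W.geomTorsion ((p ^ J : ℕ) : ℤ))]

include halt hnondeg in
/-- **The dual Kummer condition at a place `v ∣ p` of multiplicative reduction, any number field** (see the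
module docstring for the statement and the four-step proof). [cite: GreenbergLNM1716, §2 pp. 74–76 and §4 pp. 123–124]
[cite: MilneADT2006, Ch. I, Cor. 2.3] -/
theorem twistedTorsionToLocalH1_eq_zero_of_dual_finitePlace (hκ : κ.IsCyclotomic)
    (v : HeightOneSpectrum (𝓞 K)) (hv : W.HasMultiplicativeReductionAt v)
    (ιv : galoisCohomology ((mu K (p ^ J)).toLocal (Sum.inr v)) 2 →+ ZMod (p ^ J))
    (hι : Injective ιv)
    (y' : galoisCohomology ((W.twistedTorsionGaloisModule p κ J u' hu').restrictField (v.adicCompletion K)) 1)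
    (H : ∀ a : galoisCohomology ((W.twistedTorsionGaloisModule p κ J u hu).restrictField (v.adicCompletion K)) 1,
      W.twistedTorsionToLocalH1 p κ J u hu (v.adicCompletion K) a = 0 →
      localTatePairingZMod (W.twistedTorsionGaloisModule p κ J u hu) (p ^ J) (Sum.inr v) ιv a
        (galoisCohomology.map
          ((W.twistedWeilDual p κ J hu hu' huu' e hμ hadd₁ hadd₂ hgal).restrictField (v.adicCompletion K)) 1 y') =
        0) :
    W.twistedTorsionToLocalH1 p κ J u' hu' (v.adicCompletion K) y' = 0 := by
  haveI : NeZero (p ^ J) := ⟨pow_ne_zero _ hp.out.ne_zero⟩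
  haveI : CharZero K := charZero_of_injective_algebraMap (algebraMap ℚ K).injective
  haveI : CharZero (v.adicCompletion K) := charZero_adicCompletion v
  haveI : CompactSpace (absoluteGaloisGroup (v.adicCompletion K)) :=
    absoluteGaloisGroup_compactSpace (v.adicCompletion K)
  -- the Tate line `C ⊆ E[p^∞]` and its level-`J` part
  obtain ⟨N, hdiv, hcard, hKum, -⟩ := exists_tateLine_localKummer W p κ hκ hv
  let C : Submodule ℤ (W.geomTorsion ((p ^ J : ℕ) : ℤ)) :=
    (N.plus.comap (AddSubgroup.inclusion
      (Literature.Barriers.BirchSwinnertonDyer.geomTorsion_pow_le_geomPrimaryTorsion W p J))).toIntSubmodule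
  have hC : ∀ T, T ∈ C ↔ AddSubgroup.inclusion
      (Literature.Barriers.BirchSwinnertonDyer.geomTorsion_pow_le_geomPrimaryTorsion W p J) T ∈ N.plus :=
    fun T ↦ Iff.rfl
  -- the two twisted local modules (over `Γ_{K_v}`) and the line inside them
  have hCu : ∀ g, C ≤ C.comap
      (((W.twistedTorsionGaloisModule p κ J u hu).restrict (absGaloisRestrict K (v.adicCompletion K))) g) :=
    line_le_comap_twistedTorsionGaloisModule W p κ J u hu N C hC
  have hCu' : ∀ g, C ≤ C.comap
      (((W.twistedTorsionGaloisModule p κ J u' hu').restrict (absGaloisRestrict K (v.adicCompletion K))) g) :=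
    line_le_comap_twistedTorsionGaloisModule W p κ J u' hu' N C hC
  let i := subtypeHom
    ((W.twistedTorsionGaloisModule p κ J u hu).restrict (absGaloisRestrict K (v.adicCompletion K))) C hCu
  let i' := subtypeHom
    ((W.twistedTorsionGaloisModule p κ J u' hu').restrict (absGaloisRestrict K (v.adicCompletion K))) C hCu'
  -- duals over the local field `F = K_v`
  let eD := (tateDualLocalIso v (W.twistedTorsionGaloisModule p κ J u hu) (p ^ J)).hom
  let wF : ContinuousRep.toTopRep
      ((W.twistedTorsionGaloisModule p κ J u' hu').restrict (absGaloisRestrict K (v.adicCompletion K))) ⟶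
      (((W.twistedTorsionGaloisModule p κ J u hu).tateDual (p ^ J)).restrict
        (absGaloisRestrict K (v.adicCompletion K))).toTopRep :=
    TopRep.ofHom ⟨((W.twistedWeilDual p κ J hu hu' huu' e hμ hadd₁ hadd₂ hgal).restrictField
      (v.adicCompletion K)).toContinuousLinearMap,
      ((W.twistedWeilDual p κ J hu hu' huu' e hμ hadd₁ hadd₂ hgal).restrictField
        (v.adicCompletion K)).isIntertwining'⟩
  let iD : (((W.twistedTorsionGaloisModule p κ J u hu).restrict
        (absGaloisRestrict K (v.adicCompletion K))).homRep (mu (v.adicCompletion K) (p ^ J))).toTopRep ⟶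
      ((((W.twistedTorsionGaloisModule p κ J u hu).restrict
        (absGaloisRestrict K (v.adicCompletion K))).subrepresentation C hCu).homRep
          (mu (v.adicCompletion K) (p ^ J))).toTopRep :=
    ContinuousRep.homRepMap (mu (v.adicCompletion K) (p ^ J)) i
  let θ := wF ≫ eD ≫ iD
  -- unfolding `θ`: `(θ m') c = muTransfer (e(c, m'))`
  have hθ_apply : ∀ (m' : W.geomTorsion ((p ^ J : ℕ) : ℤ)) (c : C),
      θ.hom m' c = muTransfer K (v.adicCompletion K) (p ^ J)
        (weilPairingHom W (p ^ J) e hμ hadd₁ hadd₂ (c : W.geomTorsion ((p ^ J : ℕ) : ℤ)) m') := fun _ _ ↦ rfl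
  -- classes from the line die under `twistedTorsionToLocalH1` (XXVII/XXVIII), both twists
  have hBu : ∀ c : continuousCohomology 1 (((W.twistedTorsionGaloisModule p κ J u hu).restrict
      (absGaloisRestrict K (v.adicCompletion K))).subrepresentation C hCu).toTopRep,
      W.twistedTorsionToLocalH1 p κ J u hu (v.adicCompletion K) (cohomologyMap i 1 c) = 0 := fun c ↦ by
    obtain ⟨ξ, rfl⟩ := oneCocycleClass_surjective _ c
    rw [cohomologyMap_oneCocycleClass]
    exact twistedTorsionToLocalH1_oneCocycleClass_eq_zero_of_mem_line W p κ J u hu N C hC hKum _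
      (fun σ ↦ (ξ.1 σ).2)
  have hBu' : ∀ c : continuousCohomology 1 (((W.twistedTorsionGaloisModule p κ J u' hu').restrict
      (absGaloisRestrict K (v.adicCompletion K))).subrepresentation C hCu').toTopRep,
      W.twistedTorsionToLocalH1 p κ J u' hu' (v.adicCompletion K) (cohomologyMap i' 1 c) = 0 := fun c ↦ by
    obtain ⟨ξ, rfl⟩ := oneCocycleClass_surjective _ c
    rw [cohomologyMap_oneCocycleClass]
    exact twistedTorsionToLocalH1_oneCocycleClass_eq_zero_of_mem_line W p κ J u' hu' N C hC hKum _
      (fun σ ↦ (ξ.1 σ).2)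
  -- (3) `0 → C(χ_{u'}) → M_{u'} → Hom(C(χ_u), μ) → 0` is short exact
  have hn : ∀ m : W.geomTorsion ((p ^ J : ℕ) : ℤ), (p ^ J) • m = 0 := fun m ↦ AddSubgroup.torsionBy.nsmul m
  have hnC : ∀ c : C, (p ^ J) • c = 0 := fun c ↦
    Subtype.ext (by rw [AddSubmonoidClass.coe_nsmul, ZeroMemClass.coe_zero]; exact hn _)
  have hSES : IsSES i' θ := by
    refine ⟨?_, fun a b h ↦ Subtype.ext h, fun m' hm' ↦ ?_, ?_⟩
    · -- `θ ∘ i' = 0`: isotropy of `C`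
      ext c' c
      change θ.hom (c' : W.geomTorsion ((p ^ J : ℕ) : ℤ)) c = 0
      rw [hθ_apply, weilPairingHom_eq_zero_of_mem_line W p J N.plus hdiv hcard C hC e hμ hadd₁ hadd₂ halt c.2 c'.2,
        map_zero]
    · -- `ker θ = C`: maximal isotropy of `C`
      refine ⟨⟨m', mem_line_of_forall_weilPairingHom_eq_zero W p J N.plus hdiv hcard C hC e hμ hadd₁ hadd₂ halt
        hnondeg m' fun S hS ↦ ?_⟩, rfl⟩
      have h := congrArg (fun f : HomCarrier C (MuCarrier (v.adicCompletion K) (p ^ J)) ↦ f ⟨S, hS⟩) hm'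
      simp only [hθ_apply] at h
      exact muTransfer_injective K (v.adicCompletion K) (p ^ J) (h.trans (map_zero _).symm)
    · -- `θ` surjective: `w`, `e_D` bijective; restriction of characters surjective
      have h1 : Surjective wF.hom :=
        (W.twistedWeilDual_bijective p κ J hu hu' huu' e hμ hadd₁ hadd₂ hgal hnondeg).2
      have h2 : Surjective eD.hom := (tateDualTransferEquiv v (p ^ J)
        (M := W.geomTorsion ((p ^ J : ℕ) : ℤ))).surjective
      have h3 : Surjective iD.hom :=
        (ContinuousRep.isSES_homRepMap_mkQ_subtype
          ((W.twistedTorsionGaloisModule p κ J u hu).restrict (absGaloisRestrict K (v.adicCompletion K)))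
          (mu (v.adicCompletion K) (p ^ J)) C hCu
          (muEquivZMod (v.adicCompletion K) (p ^ J)) hn).surjective
      exact h3.comp (h2.comp h1)
  -- (1)+(2) `H¹(θ) y' = 0`
  have hθ : cohomologyMap θ 1 y' = 0 := by
    obtain ⟨ι, -, -, hbf⟩ := localDuality_bijective (v.adicCompletion K)
      (((W.twistedTorsionGaloisModule p κ J u hu).restrict
        (absGaloisRestrict K (v.adicCompletion K))).subrepresentation C hCu) hnC
    refine hbf.1 (a₂ := 0) ?_
    rw [map_zero]
    refine AddMonoidHom.ext fun c ↦ ?_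
    rw [AddMonoidHom.flip_apply, AddMonoidHom.zero_apply, cohomologyMap_comp_apply, cohomologyMap_comp_apply,
      ContinuousRep.dualityPairing_apply,
      ← ContPairing.cupProduct_adjoint
        ((((W.twistedTorsionGaloisModule p κ J u hu).restrict
          (absGaloisRestrict K (v.adicCompletion K))).subrepresentation C hCu).evalPairing
            (mu (v.adicCompletion K) (p ^ J)))
        (((W.twistedTorsionGaloisModule p κ J u hu).restrict
          (absGaloisRestrict K (v.adicCompletion K))).evalPairing (mu (v.adicCompletion K) (p ^ J))) i iD
        (fun x f ↦ ContinuousRep.evalPairing_homRepMap (mu (v.adicCompletion K) (p ^ J)) i x f),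
      ← ContinuousRep.dualityPairing_apply,
      ← iota_cupProduct_localPairingF v (W.twistedTorsionGaloisModule p κ J u hu) (p ^ J) ι]
    -- the hypothesis, transported: `⟨H¹(i) c, H¹(w) y'⟩ = 0`
    have h0 : (localPairingF v (W.twistedTorsionGaloisModule p κ J u hu) (p ^ J)).cupProduct
        (cohomologyMap i 1 c) (cohomologyMap wF 1 y') = 0 := by
      have h := H (cohomologyMap i 1 c) (hBu c)
      rw [DiscreteGaloisModule.localTatePairingZMod_apply] at h
      exact (injective_iff_map_eq_zero ιv).1 hι _ h
    rw [h0, map_zero, map_zero]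
  -- (3) `y'` comes from `H¹(K_v, C(χ_{u'}))`; (4) those classes die
  obtain ⟨c', hc'⟩ := hSES.exists_map_one_eq_of_map_one_eq_zero y' hθ
  rw [← hc']
  exact hBu' c'

end NumberField

/-! ## `δ2` (the hypothesis of `levelTarget_of_local_alt` / `hF3b_of_prop49_local_two`, verbatim) -/

/-- **`δ2`: the dual Kummer condition at the prime `2` for an elliptic curve over `ℚ` with multiplicative
reduction at `2`** — the hypothesis of `levelTarget_of_local_alt` (file XXIV′ `…TwistedDescentLocalAlt.lean`) and of
`hF3b_of_prop49_local_two` (file XXVI `…TwistedDescentLocalTwo.lean`), verbatim; from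
`twistedTorsionToLocalH1_eq_zero_of_dual_finitePlace` (only the injectivity of `ι_v` is used).
[cite: GreenbergLNM1716, §2 pp. 74–76 and §4 pp. 123–124] [cite: MilneADT2006, Ch. I, Cor. 2.3] -/
theorem dualKummerAtTwo :
    ∀ (W : WeierstrassCurve ℚ) [W.IsElliptic] [W.IsGloballyMinimal],
      W.HasMultiplicativeReductionAtPrime 2 →
      ∀ (κ : ZpExtension ℚ 2) (_hκ : κ.IsCyclotomic) (J : ℕ) (u u' : ℤ) (hu : (2 : ℤ) ∣ u - 1)
        (hu' : (2 : ℤ) ∣ u' - 1) (huu' : ((2 : ℤ) ^ J) ∣ u * u' - 1)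
        (e : W.geomTorsion ((2 ^ J : ℕ) : ℤ) → W.geomTorsion ((2 ^ J : ℕ) : ℤ) → AlgebraicClosure ℚ)
        (hμ : ∀ S T, e S T ^ (2 ^ J) = 1)
        (hadd₁ : ∀ S₁ S₂ T, e (S₁ + S₂) T = e S₁ T * e S₂ T)
        (hadd₂ : ∀ S T₁ T₂, e S (T₁ + T₂) = e S T₁ * e S T₂)
        (hgal : ∀ (σ : absoluteGaloisGroup ℚ) (S T : W.geomTorsion ((2 ^ J : ℕ) : ℤ)),
          σ • e S T = e (σ • S) (σ • T))
        (_halt : ∀ T, e T T = 1) (_hnondeg : ∀ T, (∀ S, e S T = 1) → T = 0),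
      ∀ [Finite (W.geomTorsion ((2 ^ J : ℕ) : ℤ))],
      ∀ (v : HeightOneSpectrum (𝓞 ℚ)), ((2 : ℕ) : 𝓞 ℚ) ∈ v.asIdeal →
      ∀ (ιv : galoisCohomology ((DiscreteGaloisModule.mu ℚ (2 ^ J)).toLocal (Sum.inr v)) 2 →+ ZMod (2 ^ J)),
        Function.Bijective ιv →
      ∀ (y' : galoisCohomology
          ((W.twistedTorsionGaloisModule 2 κ J u' hu').restrictField (v.adicCompletion ℚ)) 1),
        (∀ a : galoisCohomology
            ((W.twistedTorsionGaloisModule 2 κ J u hu).restrictField (v.adicCompletion ℚ)) 1,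
          W.twistedTorsionToLocalH1 2 κ J u hu (v.adicCompletion ℚ) a = 0 →
          localTatePairingZMod (W.twistedTorsionGaloisModule 2 κ J u hu) (2 ^ J) (Sum.inr v) ιv a
            (galoisCohomology.map
              ((W.twistedWeilDual 2 κ J hu hu' huu' e hμ hadd₁ hadd₂ hgal).restrictField
                (v.adicCompletion ℚ)) 1 y') = 0) →
        W.twistedTorsionToLocalH1 2 κ J u' hu' (v.adicCompletion ℚ) y' = 0 :=
  fun W _ _ hmult κ hκ J _ _ hu hu' huu' e hμ hadd₁ hadd₂ hgal halt hnondeg _ v hv ιv hι y' H ↦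
    twistedTorsionToLocalH1_eq_zero_of_dual_finitePlace W 2 κ J hu hu' huu' e hμ hadd₁ hadd₂ hgal halt hnondeg
      hκ v (GreenbergVatsalStrictSelmerMultiplicative.hasMultiplicativeReductionAt_of_mem W 2 hmult hv) ιv hι.1
      y' H

end Summit.BirchSwinnertonDyer.BirchSwinnertonDyer.Theorems.MultTransportTwistedDescent

end
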